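/-
Copyright (c) 2026 the pub-hodgecm-mathlib formalisation cell (harness21).  Prover seat hodgecm-mathlib-K2E3-p12 (g9) (W3b, generator of the L4 architect K2E3-p25 (g3)), HCML Track B «K2-LIT» ∕ h413
(`stmt-HodgeConjecture-24833`).  NR-1′ «LeThree SWEEP» (director s1979∕s1980): the hHC∕hHCB-binding theorems of ★ `K2E3PseudoCoeffTraceOfPins` RE-READ under the NARROWED letters
hHC₃ `characterLocallyIntegrableLeThree` ∕ hHCB₃ `normalizedCharacter_locallyBoundedLeThree` (`2 ≤ N ≤ 3`, `v` non-split) — SAME NAMES, namespace `…K2E3PseudoCoeffTraceOfPinsLeThree`.  2026-09-04.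
-/
import Summits.HodgeConjecture.HodgeConjecture.Theorems.F0P3cStCharTSWeylDatumPinsWIF  -- ★ (LH5-p02) WIF-AT-THE-DATUM by pins: `weylIntegrationFormula_of_datumPins`
import Summits.HodgeConjecture.HodgeConjecture.Theorems.F0P3cStCharTSJacCartanTerminus  -- ★ JAC-ELL C8 terminus: `tubeJacobianSocket_compactCartan` (the compact-Cartan socket, unconditional)
import Summits.HodgeConjecture.HodgeConjecture.Theorems.F0P3cStCharTSCartanReps         -- ★ `exists_isRegularElt_centralizer_eq_cmTorus` (`M = Z(m₀)`, `m₀` regular)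
import Summits.HodgeConjecture.HodgeConjecture.Theorems.F0P3cStCharTSCartanFields       -- ★ (LH6-p01) S9a: `ellCartanAE_of_compact_centralizers` (C2), `nonEllCartanAE_of_split` (C3)
import Summits.HodgeConjecture.HodgeConjecture.Theorems.F0P3cStCharTSCartanNull         -- ★ (F0P3-p04) S9b′: `cartanNull_of_rootKernels`
import Summits.HodgeConjecture.HodgeConjecture.Theorems.F0P3cStCharTSDGField            -- ★ (LH4-p02) DG-FIELD: `measurable_DG`, `DG_eq_zero_or_le`
import Summits.HodgeConjecture.HodgeConjecture.Theorems.F0P3cStCharTSL2dOfHcb           -- ★ (LH6-p02) S9c: `l2CharOnTorusAll_of_hcBounded` ((L2D∀) ⟸ (hHCB) + (M1∀))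
import Summits.HodgeConjecture.HodgeConjecture.Theorems.F0P3cStCharTSPctOut             -- ★ (LH6-p01) PCT-OUT: `pseudoCoeffTrace_Gqs`
import HarnessLib
import Summits.HodgeConjecture.HodgeConjecture.Theorems.K2E3PseudoCoeffTraceOfPins   -- ★ the original: every non-letter lemma REUSED by qualified name
import Summits.HodgeConjecture.HodgeConjecture.Theorems.K2E3CharLettersLeThreeDefs   -- NR-1′ root: hHC₃ ∕ hHCB₃
import Summits.HodgeConjecture.HodgeConjecture.Theorems.K2E3L2dOfHcbLeThree   -- NR-1′ twin of ★ L2dOfHcb (site :139)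

/-!
# NR-1′ twin — ★ `K2E3PseudoCoeffTraceOfPins` under the narrowed Harish-Chandra letters (`2 ≤ N ≤ 3`, `v` non-split)

Cell `pub/hodgecm-mathlib`, crux H413 = `stmt-HodgeConjecture-24833`, line L4 `stub_StCharTS`; director rulings NR-1′ (s1979) ∕ «GO — LeThree SWEEP» (s1980); architect memo
`K2/K2E3-p25/g3/NR1-narrowing-cone.K2E3-p25-g3.md`.  THEOREMS ONLY; count-neutral helper (`--supports stmt-HodgeConjecture-24833 --as helper`).  Exactly the theorems of the
original ★ file whose statements bind `Ch1.characterLocallyIntegrable` ∕ `normalizedCharacter_locallyBounded`, copied with the binder TYPE replaced by hHC₃ ∕ hHCB₃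
(★ `K2E3CharLettersLeThreeDefs`), the rank∕non-split arguments supplied at each application (`2 ≤ N`, `N ≤ 3` by `norm_num`; the organ's `∀ w ∣ v, conj • w = w`), an added `hns`
binder where the original head was place-agnostic, and calls into other cone files re-pointed to their twins; every other lemma of the original is used BY QUALIFIED NAME.
No new mathematics.  The original ★ declarations are untouched.

HONEST LABEL: HC_CM is proved only modulo the 7 printed citations (2 remaining named inputs: hLiu418 = `stmt-HodgeConjecture-24832`, h413 = `stmt-HodgeConjecture-24833`) until rung 0
closes; count-neutral; CONDITIONAL on the narrowed letters (stated, not assumed).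

## References
* [Rogawski1990] J. D. Rogawski, *Automorphic Representations of Unitary Groups in Three Variables* (1990), §1.6 p. 5; §4.9 p. 54; §12.5–12.7.
* [HarishChandra1999AdmissibleDistributions] Harish-Chandra, *Admissible Invariant Distributions on Reductive p-adic Groups*, ULS 16 (1999), Thm. 16.3.
-/

set_option autoImplicit false
-- the mandated namespace has the single-problem summit's repeated segment (`HodgeConjecture.HodgeConjecture`)
set_option linter.dupNamespace false

noncomputable section

open MeasureTheory Measure Filter Topology NumberField IsDedekindDomain
open scoped NNReal Matrix MatrixGroups
open Literature.MeasureTheory.Group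
open Literature.NumberTheory.Rogawski1990 Literature.NumberTheory.Rogawski1990.Ch12Sec5
open Literature.NumberTheory.Automorphic Literature.NumberTheory.Automorphic.UnitaryGroup
open Summit.HodgeConjecture.HodgeConjecture.Cruxes.H413
open Summit.HodgeConjecture.HodgeConjecture.Cruxes.H413.F0P3cStCharTSTorusDefs

open Summit.HodgeConjecture.HodgeConjecture.Cruxes.H413.K2E3CharLettersLeThreeDefs

namespace Summit.HodgeConjecture.HodgeConjecture.Cruxes.H413.K2E3PseudoCoeffTraceOfPinsLeThree

section CM

variable (L : Type) [Field L] [NumberField L] [IsCMField L] (v : HeightOneSpectrum (𝓞 ↥(maximalRealSubfield L)))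

set_option maxHeartbeats 1600000 in
set_option synthInstance.maxHeartbeats 400000 in
-- instance-term unification on the CM local carriers (as ★ ScPseudoCoeff ∕ ★ DatumJunction15)
/-- **«`Tr π′(f_π) = ⟨χ_{π′}, χ_π⟩_e`» AT THE U5 FRAME'S PINS.**  On `G = Gqs L v = U(Φ₃)(L⁺_v)` (`v` non-split, `hns`) with Haar measure `νQv` and the canonical orbital
family `mQv` (`hcanQ`), for every §12.5 datum `𝔇` carrying the pins `hC01 hC04 hC05 hE hchar hAll hHaar hcart hHaarG hfinG hker eDG hcovA hncA hcptA hinvT hcoreT` of the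
block (tokens of `sig_K2E3PseudoCoeffValueAtOneL2`'s telescope, verbatim), and GIVEN Harish-Chandra's local boundedness (hHCB) `normalizedCharacter_locallyBoundedLeThree`:
the carpet relation ★ `Ch12Sec6.PseudoCoeffTrace 𝔇` — for every class `π′` and every pseudo-coefficient `f` of `π`, `Tr π′(f) = ⟨χ_{π′}, χ_π⟩_e`.  PROOF (= ★
DatumJunction15 :262–283): WIF from the pins (★ `weylIntegrationFormula_of_datumPins`, compact-Cartan socket ★ `tubeJacobianSocket_compactCartan`, `M = Z(m₀)` by ★
`exists_isRegularElt_centralizer_eq_cmTorus`); (C1) from `hAll`; (C2) ★ `ellCartanAE_of_compact_centralizers` ∘ ★ `cartanNull_of_rootKernels`; (C3) ★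
`nonEllCartanAE_of_split`; (L2D∀) ★ `l2CharOnTorusAll_of_hcBounded` with ★ `measurable_DG` ∕ `DG_eq_zero_or_le` from `eDG`; then ★ `pseudoCoeffTrace_Gqs`.
[cite: Rogawski1990, §12.6 p. 187] [cite: Rogawski1990, §12.5 p. 182] [cite: HarishChandra1999, Thm. 16.3] -/
theorem pseudoCoeffTrace_of_pins
    (hns : ∀ w : PlacesOver L v, IsCMField.complexConj L • w.1 = w.1)
    (hHCB : normalizedCharacter_locallyBoundedLeThree)
    [MeasurableSpace (Gqs L v)] [BorelSpace (Gqs L v)]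
    [∀ γ : Gqs L v, MeasurableSpace (Gqs L v ⧸ Subgroup.centralizer ({γ} : Set (Gqs L v)))]
    [∀ γ : Gqs L v, BorelSpace (Gqs L v ⧸ Subgroup.centralizer ({γ} : Set (Gqs L v)))]
    [MeasurableSpace (Gqs L v ⧸ Subgroup.center (Gqs L v))]
    {H : Type} [Group H] [TopologicalSpace H] [IsTopologicalGroup H] [MeasurableSpace H]
    (νQv : Measure (Gqs L v)) [νQv.IsHaarMeasure] [νQv.IsMulRightInvariant]
    (mQv : OrbitalMeasureFamily (Gqs L v))
    (hcanQ : mQv.IsCanonical (fun γ => IsRegularElt (γ.val : GL (Fin 3) (UnitaryGroup.LocalRing L v))) νQv)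
    (𝔇 : EllipticData (Gqs L v) H)
    (hC01 : 𝔇.μG = νQv) (hC04 : 𝔇.orb = mQv)
    (hC05 : ∀ γ : Gqs L v, γ ∈ 𝔇.regG ↔ IsRegularElt (γ.val : GL (Fin 3) (UnitaryGroup.LocalRing L v)))
    (hE : ∀ γ : Gqs L v, γ ∈ 𝔇.ellG ↔ IsRegularElt (γ.val : GL (Fin 3) (UnitaryGroup.LocalRing L v)) ∧ γ ∉ hyperbolicSet L v)
    (hchar : ∀ π : IrrClass (Gqs L v), Measurable (𝔇.char π) ∧ LocallyIntegrable (𝔇.char π) 𝔇.μG ∧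
      (∀ x ∈ 𝔇.regG, ∀ᶠ y in 𝓝 x, 𝔇.char π y = 𝔇.char π x) ∧
      ∀ φ : Gqs L v → ℂ, IsLocSmooth φ → π.smoothTrace 𝔇.μG φ = ∫ x, φ x * 𝔇.char π x ∂𝔇.μG)
    (hAll : ∀ T : Subgroup (Gqs L v), T ∈ 𝔇.cartanAll ↔ T = (cmBorelTriple L 3 v).M ∨ T ∈ 𝔇.cartanG)
    (hHaar : (𝔇.μT (cmBorelTriple L 3 v).M).IsHaarMeasure)
    (hcart : ∀ T ∈ 𝔇.cartanG, IsCompact (T : Set (Gqs L v)) ∧ ∃ γ₀ : Gqs L v,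
      IsRegularElt (γ₀.val : GL (Fin 3) (UnitaryGroup.LocalRing L v)) ∧ T = Subgroup.centralizer ({γ₀} : Set (Gqs L v)))
    (hHaarG : ∀ T ∈ 𝔇.cartanG, (𝔇.μT T).IsHaarMeasure)
    (hfinG : ∀ T ∈ 𝔇.cartanG, IsFiniteMeasure (𝔇.μT T))
    (hker : ∀ T ∈ 𝔇.cartanG, ∃ s : Finset (Subgroup ↥T), (∀ K ∈ s, IsClosed (K : Set ↥T) ∧ ¬ IsOpen (K : Set ↥T)) ∧
      ∀ t : ↥T, ¬ IsRegularElt ((t : Gqs L v).val : GL (Fin 3) (UnitaryGroup.LocalRing L v)) → ∃ K ∈ s, t ∈ K)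
    (eDG : ∀ g : Gqs L v, 𝔇.DG g = ((NNReal.sqrt (NNReal.sqrt ((∏ w : PlacesOver L v,
      Literature.NumberTheory.GaloisRepresentations.IsNonarchimedeanLocalField.normAbs (w.1.adicCompletion L)
        (((g.val : GL (Fin 3) (UnitaryGroup.LocalRing L v)).val.charpoly.discr) w)) * ((∏ w : PlacesOver L v,
      Literature.NumberTheory.GaloisRepresentations.IsNonarchimedeanLocalField.normAbs (w.1.adicCompletion L)
        (((g.val : GL (Fin 3) (UnitaryGroup.LocalRing L v)).val.det) w)) ^ 2)⁻¹)) : NNReal) : ℝ))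
    (hcovA : ∀ γ : Gqs L v, IsRegularElt (γ.val : GL (Fin 3) (UnitaryGroup.LocalRing L v)) →
      ∃ T' ∈ 𝔇.cartanAll, ∃ x : Gqs L v, ∀ g : Gqs L v, g ∈ Subgroup.centralizer ({γ} : Set (Gqs L v)) ↔ x⁻¹ * g * x ∈ T')
    (hncA : ∀ T' ∈ 𝔇.cartanAll, ∀ T'' ∈ 𝔇.cartanAll, T' ≠ T'' → ∀ y : Gqs L v, ¬ ∀ h : Gqs L v, h ∈ T'' ↔ y⁻¹ * h * y ∈ T')
    (hcptA : ∀ T' ∈ 𝔇.cartanAll, T' ≠ (cmBorelTriple L 3 v).M → IsCompact (T' : Set (Gqs L v)))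
    (hinvT : ∀ T' ∈ 𝔇.cartanAll, (𝔇.μT T').IsInvInvariant)
    (hcoreT : ∀ T' ∈ 𝔇.cartanAll, 𝔇.μT T' (compactCore ↥T') = 1) :
    Ch12Sec6.PseudoCoeffTrace 𝔇 := by
  -- ### WIF at the pins (★ WIF-AT-THE-DATUM, the compact-Cartan socket by ★ JAC-ELL C8, `M = Z(m₀)` by ★ CartanReps)
  have hShapeA : ∀ T' ∈ 𝔇.cartanAll, ∃ γ₀ : Gqs L v, IsRegularElt (γ₀.val : GL (Fin 3) (UnitaryGroup.LocalRing L v)) ∧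
      T' = Subgroup.centralizer ({γ₀} : Set (Gqs L v)) := fun T' hT' => by
    rcases (hAll T').1 hT' with h | h
    · subst h
      obtain ⟨m₀, -, hreg, hZ⟩ := F0P3cStCharTSCartanReps.exists_isRegularElt_centralizer_eq_cmTorus L v hns
      exact ⟨m₀, hreg, hZ.symm⟩
    · exact (hcart T' h).2
  have hHaarT : ∀ T' ∈ 𝔇.cartanAll, (𝔇.μT T').IsHaarMeasure := fun T' hT' => by
    rcases (hAll T').1 hT' with h | h
    · subst h; exact hHaar
    · exact hHaarG T' h
  have hWIF : 𝔇.WeylIntegrationFormula :=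
    F0P3cStCharTSWeylDatumPinsWIF.weylIntegrationFormula_of_datumPins L v hns νQv mQv 𝔇 hC01 hC04 hcanQ hC05 hShapeA hcovA hncA hcptA
      hHaarT hinvT hcoreT eDG (F0P3cStCharTSJacCartanTerminus.tubeJacobianSocket_compactCartan L v hns νQv)
  -- ### (C1) (C2) (C3) from the Cartan pins (★ CartanFields ∕ ★ CartanNull)
  have hC2 : 𝔇.EllCartanAE :=
    F0P3cStCharTSCartanFields.ellCartanAE_of_compact_centralizers L v 𝔇 hE hcart
      (F0P3cStCharTSCartanNull.cartanNull_of_rootKernels L v 𝔇 hHaarG (fun T hT => (hcart T hT).1) hker)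
  have hC1 : 𝔇.EllCartanSubset := fun T hT => (hAll T).2 (Or.inr hT)
  have hC3 : 𝔇.NonEllCartanAE :=
    F0P3cStCharTSCartanFields.nonEllCartanAE_of_split L v 𝔇 hC05 hE (fun T hT hTn => ((hAll T).1 hT).resolve_right hTn) hHaar
  -- ### (L2D∀) from (hHCB) + (M1∀) + the closed form of `D_G` (★ L2D-OF-HCB, ★ DG-FIELD)
  have hDGm : Measurable 𝔇.DG := F0P3cStCharTSDGField.measurable_DG L v 𝔇 eDG
  have hDG := F0P3cStCharTSDGField.DG_eq_zero_or_le L v 𝔇 eDG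
  have hL2 : 𝔇.L2CharOnTorusAll :=
    K2E3L2dOfHcbLeThree.l2CharOnTorusAll_of_hcBounded L v hHCB hns νQv 𝔇 hC01 hC05 hchar hDGm (fun T hT => (hcart T hT).1) hfinG hDG
  -- ### ★ PCT-OUT
  exact F0P3cStCharTSPctOut.pseudoCoeffTrace_Gqs L v hns νQv 𝔇 hC01 hC05 hchar hWIF hC1 hC2 hC3 hL2

end CM

end Summit.HodgeConjecture.HodgeConjecture.Cruxes.H413.K2E3PseudoCoeffTraceOfPinsLeThree

end
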